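import Mathlib
import Literature.NumberTheory.DiophantineGeometry.StewartYuPadicLogFormsProofs
import HarnessLib

/-!
# TheoremALeOne

Topic `Literature/Uncategorized`. Named literature fact(s) relocated by the gate from `Summits/ABC/ABC/Theorems/PadicPrincipalCoreST86TheoremALeOne.lean`
(accept-time relocation of `[cite]`d propositions written inline in a Summits proposal; human ruling 2026-08-15).
Sources: Yu1989.

* `Literature.Uncategorized.TheoremALeOne`
-/

namespace Literature.Uncategorized

open Finset
open Literature.NumberTheory.DiophantineGeometry

/-- Rung of `TheoremA`: the statement of `Summit.ABC.ABC.Theses.PadicPrincipalCoreST86.TheoremA` with the extra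
hypothesis `m ≤ 1` (one principal `p`-adic logarithm). [cite: Yu1989, Lemma 1.4] -/
def TheoremALeOne : Prop := ∃ (C : ℕ → ℝ) (r : ℕ → ℕ) (c₁ c₂ : ℝ), 1 ≤ c₁ ∧ 0 ≤ c₂ ∧ c₂ ≤ 10 ∧ (∀ m, 0 ≤ C m ∧ C m ≤ c₁ ^ m * (m : ℝ) ^ (c₂ * m)) ∧ (∀ (p : ℕ), p.Prime → p ≠ 2 → ∀ (m : ℕ) (α : Fin m → ℚ) (b : Fin m → ℤ) (V : Fin m → ℝ) (Vmax W : ℝ), m ≤ 1 → (∀ j, α j ≠ 0 ∧ 1 ≤ padicValRat p (α j - 1)) → (∀ μ : Fin m → ℤ, ∏ j, α j ^ μ j = 1 → μ = 0) → (∀ T : Finset (Fin m), T.Nonempty → ¬ IsSquare (∏ j ∈ T, α j)) → (∀ j, Height.logHeight₁ (α j) ≤ V j) → (∀ j, Real.log p ≤ V j) → (∀ j, V j ≤ Vmax) → b ≠ 0 → (∀ j, Real.log (max 3 (|b j| : ℝ)) ≤ W) → (padicValRat p (∏ j, α j ^ b j - 1) : ℝ) * Real.log p ≤ C m * (∏ j,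 V j) * (W + Real.log (2 * Vmax)) * Real.log (2 * Vmax) / Real.log p ^ r m)

end Literature.Uncategorized
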